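import Summits.CriticalPhenomena.CardyFormulaZ2.Theses.CardySelfRefinement

/-!
# `stub_lawCriterion` pays for the one-sided filter: a two-sided conclusion is FALSE

Negative-lane helper for crux item stmt-CriticalPhenomena-10279
(`CardySelfRefinement.SubseqUpgrade`, line `uniqueness-pin-subsequence`, registered stub
`stub_lawCriterion`), drefute (gen 1 finding, p79100 bounced only by a gate restart; re-derived
and re-filed by gen 2). The stub concludes `TendstoLaw`, i.e. convergence along the ONE-SIDED mesh
filter `𝓝[>] 0`, from witnesses along everywhere-POSITIVE null sequences. Kernel-checked here:
the same hypothesis does NOT give convergence along the punctured two-sided filter `𝓝[≠] 0` —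
the positivity guard of the hypothesis is exactly matched by the one-sided filter of the
conclusion, neither more nor less (cf. `Negative.lawCriterionOn_iff`-type dichotomies of the
standing Disproof, which live inside `(0, ∞)`). Conclusion is a negation; no Theses declaration
is asserted. Billingsley (1999), Thm. 2.6. Definition-free; axioms standard.
-/

open Filter Topology MeasureTheory
open scoped BoundedContinuousFunction
open Literature.Probability.RandomPlanarGeometry

namespace Summit.CriticalPhenomena.CardyFormulaZ2.Theorems.SubseqUpgrade.Negative

/-- **The hypothesis of `stub_lawCriterion` does not control negative meshes.** It is FALSE that
subsequential convergence along every everywhere-positive null sequence (even with one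
`StrictMono` subsequence serving all test functions) implies convergence of
`δ ↦ ∫ f (Y δ ·) dP δ` along the punctured two-sided filter `𝓝[≠] 0`. Witness: one-point
configuration spaces with Dirac laws, target `X = ℝ`, the deterministic "interface"
`Y δ = if δ < 0 then 1 else 0`, limit `Z = 0`: along positive sequences the laws are constantly
`δ_0` (hypothesis holds with `φ = id`), along `-1/(n+1) → 0` within `{0}ᶜ` they are `δ_1`, and
the clamp test function (`0 ↦ 0`, `1 ↦ 1`) separates. [folklore] -/
theorem lawCriterion_false_twoSided :
    ¬ ∀ {Ωδ : ℝ → Type} [∀ δ, MeasurableSpace (Ωδ δ)] {Ω' : Type} [MeasurableSpace Ω']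
        {X : Type} [TopologicalSpace X]
        (Y : ∀ δ, Ωδ δ → X) (P : ∀ δ, Measure (Ωδ δ)) (Z : Ω' → X) (P' : Measure Ω'),
        (∀ s : ℕ → ℝ, (∀ n, 0 < s n) → Tendsto s atTop (𝓝 0) →
            ∃ φ : ℕ → ℕ, StrictMono φ ∧ ∀ f : X →ᵇ ℝ,
              Tendsto (fun n ↦ ∫ ω, f (Y (s (φ n)) ω) ∂P (s (φ n))) atTop
                (𝓝 (∫ ω, f (Z ω) ∂P'))) →
          ∀ f : X →ᵇ ℝ, Tendsto (fun δ ↦ ∫ ω, f (Y δ ω) ∂P δ) (𝓝[≠] (0 : ℝ))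
            (𝓝 (∫ ω, f (Z ω) ∂P')) := by
  intro h
  -- a bounded continuous test function on `ℝ` with `g 0 = 0`, `g 1 = 1` (the clamp)
  obtain ⟨g, hg0, hg1⟩ : ∃ g : ℝ →ᵇ ℝ, g 0 = 0 ∧ g 1 = 1 :=
    ⟨BoundedContinuousFunction.ofNormedAddCommGroup (fun x : ℝ => max 0 (min 1 x))
      (continuous_const.max (continuous_const.min continuous_id)) 1 fun x => by
        rw [Real.norm_eq_abs, abs_le]
        exact ⟨by linarith [le_max_left (0 : ℝ) (min 1 x)], max_le zero_le_one (min_le_left _ _)⟩,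
      by simp, by simp⟩
  have key := @h (fun _ => Unit) (fun _ => inferInstance) Unit _ ℝ _
    (fun δ _ => if δ < 0 then (1 : ℝ) else 0) (fun _ => Measure.dirac ()) (fun _ => (0 : ℝ))
    (Measure.dirac ()) ?_ g
  · -- along `-1/(n+1) → 0` within `{0}ᶜ` the statistic is constantly `g 1 = 1 ≠ 0 = g 0`
    have hs : Tendsto (fun n : ℕ => -(1 / ((n : ℝ) + 1))) atTop (𝓝[≠] (0 : ℝ)) := by
      refine tendsto_nhdsWithin_iff.2 ⟨?_, Eventually.of_forall fun n => ?_⟩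
      · have h0 := (tendsto_one_div_add_atTop_nhds_zero_nat (𝕜 := ℝ)).neg
        rw [neg_zero] at h0
        exact h0
      · exact Set.mem_compl_singleton_iff.2 (neg_ne_zero.2 (Nat.one_div_pos_of_nat).ne')
    have h1 : Tendsto (fun _ : ℕ => (1 : ℝ)) atTop (𝓝 (∫ _ω : Unit, g 0 ∂Measure.dirac ())) :=
      (key.comp hs).congr fun n => by
        show (∫ _ω : Unit, g (if -(1 / ((n : ℝ) + 1)) < 0 then (1 : ℝ) else 0)
          ∂Measure.dirac ()) = 1
        rw [if_pos (neg_neg_of_pos Nat.one_div_pos_of_nat), integral_dirac, hg1]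
    rw [integral_dirac, hg0] at h1
    exact zero_ne_one (tendsto_nhds_unique h1 tendsto_const_nhds)
  · -- along positive sequences the statistic is constantly `∫ f 0`: the hypothesis holds
    intro s hs _
    refine ⟨id, strictMono_id, fun f => ?_⟩
    refine (tendsto_const_nhds (x := ∫ _ω : Unit, f 0 ∂Measure.dirac ())).congr fun n => ?_
    show _ = ∫ _ω : Unit, f (if s (id n) < 0 then (1 : ℝ) else 0) ∂Measure.dirac ()
    rw [if_neg (not_lt.2 (hs _).le)]

end Summit.CriticalPhenomena.CardyFormulaZ2.Theorems.SubseqUpgrade.Negative
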